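import Summits.AtomisticToContinuum.HydrodynamicLimit.Theses.AnnealedZeroHorizon
import Summits.AtomisticToContinuum.HydrodynamicLimit.Theorems.AnnealedZeroHorizonDefs

/-!
# RE-TYPE PROPOSAL (lead c2, 2026-08-17) for the crux `AnnealedWeakStrong` (stmt-AtomisticToContinuum-9258)

NOT a proof and NOT a proposal to the gate: a planner-facing, ELABORATING (`lean check` rc 0, no sorry) draft of
the statements that should REPLACE `MeanFluxClosure` / `MeanSecondLaw` / `AnnealedWeakStrong` so that the
annealed weak–strong crux becomes provable with the engine the tree holds PROVED
(`Literature.Analysis.FluidPDE.CompressibleEuler.brezinaFeireisl2018_thm_3_3_holds` and its pointwise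
machinery `MVRelativeEnergy*`), re-using VERBATIM the landed pieces of line `registered`
(S1 `stub_timeZeroMeanConvergence` p145914, S3a `stub_hsRelEtaCoercive` p146666, S3b
`stub_smallRelEntropyFieldsClose` p146993, S3c `stub_fieldsCloseTendsto` p145913, objects `AWS.*`).

Why a re-type and not a new line (memo `LeadC2-verdict.md`): with the GLOBAL `MeanSecondLaw` the only
coercive functional linear in the law is the Bregman divergence `E∫η_σ(U|Ū)`, whose energy coefficient
`−1/θ̄(t,x)` is forced, so the energy balance must be tested with a non-constant function and the CUBIC
energy-flux remainder appears (R1, kernel-checked p147041 `stub_energyFluxObstruction`); the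
Březina–Feireisl / Feireisl–Novotný relative ENERGY tests the energy balance with the constant `1` only —
no cubic remainder — but needs the entropy inequality tested with `θ̄(t,x) ≥ 0`, i.e. a LOCAL second law,
which `MeanSecondLaw` (test function `≡ 1`, FjordholmEtAl2020 Def. 27(ii)) does not give; FLMW's own
Lemma 28 closes with the global inequality only under `‖f''‖_∞ < ∞`, `c ≤ η'' ≤ C` (p. 10–11), false for Euler.
Hence: keep the route's ANNEALED, KERNEL (macroscopic `ℓ` after `N → ∞`) format, but type the two
microscopic inputs as the kernel twins of route BoxDissipativeWeakStrong's K1 `FluxClosure` (momentum only,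
CUT pressure) and K2 `EntropyAdmissibility` (LOCAL, clamp-renormalised, cut free energy), and the crux as
`K1ker → K2ker → <HydrodynamicLimit body>`; mass is exact (`MassContinuity`, proved) and energy is used only
through exact pathwise conservation (`IsHardSphereTrajectory.configEnergy_eq_holds`), so MFC's energy clause
and the raw EOS above the band disappear from the load-bearing path.

All three defs below elaborate against the current tree; names are suggestions (namespace `…AWS.Retype`,
nothing here is registered or cited as a fact).
-/

noncomputable section

open MeasureTheory Filter Set
open scoped ENNReal Topology InnerProductSpace

namespace Summit.AtomisticToContinuum.HydrodynamicLimit.Theorems.AWS.Retype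

open Literature.MathematicalPhysics.KineticTheory Literature.Analysis.FluidPDE
open Summit.AtomisticToContinuum.HydrodynamicLimit.Theses

/-- **K1ker — annealed momentum-flux closure on the CUT hard-sphere pressure, kernel format, space-time test
fields.** For every band `η₁ > 0`, all continuous positive profiles, `σ < σ₀(η₁, profiles)`, every flow family,
every horizon `T' > 0`, every smooth space-time vector field `w` on `[0,T') × 𝕋³`, every `τ ∈ [0,T')` and
`ε > 0` there is `ℓ > 0` such that for every continuous probability kernel `k` in the `ℓ`-ball, eventually in `N`,
the pathwise momentum-balance defect of the `k`-mollified fields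
`⟨m^k(τ), w(τ)⟩ − ⟨m^k(0), w(0)⟩ − ∫₀^τ∫ (m^k·∂ₜw + (m^k⊗m^k/ρ^k):∇w + p_cut div w) dx ds`,
`p_cut = ρ^k θ^k Z(min(ρ^kσ³, η₁))`, is integrable under the local Gibbs law with |mean| ≤ ε.
(Twin of `BoxDissipativeWeakStrong.FluxClosure`; differs from `MeanFluxClosure` by: momentum only, cut
pressure, time-dependent test field with the `∂ₜw` term, no Euler solution in the hypotheses.) -/
def MeanMomentumFluxClosureCut : Prop :=
  ∀ η₁ : ℝ, 0 < η₁ →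
  ∀ (a₀ θ₀ : T3 → ℝ) (u₀ : T3 → V3), Continuous a₀ → Continuous θ₀ → Continuous u₀ →
    (∀ x, 0 < a₀ x) → (∀ x, 0 < θ₀ x) →
    ∃ σ₀ : ℝ, 0 < σ₀ ∧ ∀ σ : ℝ, 0 < σ → σ < σ₀ →
      ∀ Φ : (N : ℕ) → HardSphereFlow (Literature.Analysis.FluidPDE.Torus.geometry (Fin 3)) (hsDiameter σ N) (N + 1),
      ∀ T' : ℝ, 0 < T' → ∀ w : ℝ → T3 → V3, Literature.Analysis.FunctionSpaces.Torus.IsSmoothSpaceTimeOn (Ico 0 T') w →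
      ∀ τ ∈ Ico 0 T', ∀ ε : ℝ, 0 < ε → ∃ ℓ : ℝ, 0 < ℓ ∧ ∀ k : T3 → ℝ, IsKernel ℓ k → ∀ᶠ N in atTop,
        let Mv := fun (s : ℝ) (z : Config (N + 1) (Fin 3) T3) (x : T3) => (mollState k ((Φ N).flow s z) x).2.1
        let R := fun (s : ℝ) (z : Config (N + 1) (Fin 3) T3) (x : T3) => (mollState k ((Φ N).flow s z) x).1
        let En := fun (s : ℝ) (z : Config (N + 1) (Fin 3) T3) (x : T3) => (mollState k ((Φ N).flow s z) x).2.2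
        let Θ := fun (s : ℝ) (z : Config (N + 1) (Fin 3) T3) (x : T3) =>
          2 / 3 * (En s z x / R s z x - ‖Mv s z x‖ ^ 2 / (2 * R s z x ^ 2))
        let Pc := fun (s : ℝ) (z : Config (N + 1) (Fin 3) T3) (x : T3) =>
          R s z x * Θ s z x * hsCompressibility (min (R s z x * σ ^ 3) η₁)
        let D : Config (N + 1) (Fin 3) T3 → ℝ := fun z =>
          (∫ x, ⟪Mv τ z x, w τ x⟫_ℝ) - (∫ x, ⟪Mv 0 z x, w 0 x⟫_ℝ) -
            ∫ s in Ioc 0 τ, ∫ x,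
              (⟪Mv s z x, Literature.Analysis.FunctionSpaces.Torus.timeDerivWithin (Ico 0 T') w s x⟫_ℝ +
                (∑ i, ∑ j, Mv s z x i * Mv s z x j / R s z x *
                  Literature.Analysis.FunctionSpaces.Torus.partialDeriv j (fun y => w s y i) x) +
                Pc s z x * Literature.Analysis.FunctionSpaces.Torus.divergence (w s) x)
        Integrable D (localGibbsLaw σ a₀ u₀ θ₀ N (Φ N)) ∧
          |∫ z, D z ∂(localGibbsLaw σ a₀ u₀ θ₀ N (Φ N))| ≤ ε

/-- **K2ker — annealed LOCAL clamp-renormalised second law, kernel format.** For every band `η₁ > 0`, clamps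
`a < b`, continuous positive profiles, `σ < σ₀`, flow family, horizon `T' > 0`, smooth NONNEGATIVE space-time
test function `φ` on `[0,T') × 𝕋³`, `τ ∈ [0,T')` and `ε > 0` there is `ℓ > 0` such that for every kernel `k` in
the `ℓ`-ball, eventually in `N`, the pathwise renormalised entropy-balance defect
`∫₀^τ∫ (ρ^k Z_{a,b}(ŝ) ∂ₜφ + Z_{a,b}(ŝ) m^k·∇φ) dx ds − [∫ ρ^k Z_{a,b}(ŝ) φ]₀^τ`
(`ŝ = 3/2 log θ^k − log ρ^k − F_cut(ρ^kσ³)`, `F_cut(η) = f_ex(min η η₁) + (Z(η₁)−1) log(max η η₁/η₁)`,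
`Z_{a,b} = max a ∘ min · b`) is integrable under the local Gibbs law with mean `≤ ε` (physical entropy can only
be produced, locally, in mean). (Twin of `BoxDissipativeWeakStrong.EntropyAdmissibility`; replaces the GLOBAL,
un-renormalised, Bochner-in-`x` `MeanSecondLaw`.) -/
def MeanLocalEntropyInequality : Prop :=
  ∀ η₁ : ℝ, 0 < η₁ → ∀ a b : ℝ, a < b →
  ∀ (a₀ θ₀ : T3 → ℝ) (u₀ : T3 → V3), Continuous a₀ → Continuous θ₀ → Continuous u₀ →
    (∀ x, 0 < a₀ x) → (∀ x, 0 < θ₀ x) →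
    ∃ σ₀ : ℝ, 0 < σ₀ ∧ ∀ σ : ℝ, 0 < σ → σ < σ₀ →
      ∀ Φ : (N : ℕ) → HardSphereFlow (Literature.Analysis.FluidPDE.Torus.geometry (Fin 3)) (hsDiameter σ N) (N + 1),
      ∀ T' : ℝ, 0 < T' → ∀ φ : ℝ → T3 → ℝ, Literature.Analysis.FunctionSpaces.Torus.IsSmoothSpaceTimeOn (Ico 0 T') φ →
      (∀ t ∈ Ico 0 T', ∀ x, 0 ≤ φ t x) →
      ∀ τ ∈ Ico 0 T', ∀ ε : ℝ, 0 < ε → ∃ ℓ : ℝ, 0 < ℓ ∧ ∀ k : T3 → ℝ, IsKernel ℓ k → ∀ᶠ N in atTop,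
        let Mv := fun (s : ℝ) (z : Config (N + 1) (Fin 3) T3) (x : T3) => (mollState k ((Φ N).flow s z) x).2.1
        let R := fun (s : ℝ) (z : Config (N + 1) (Fin 3) T3) (x : T3) => (mollState k ((Φ N).flow s z) x).1
        let En := fun (s : ℝ) (z : Config (N + 1) (Fin 3) T3) (x : T3) => (mollState k ((Φ N).flow s z) x).2.2
        let Θ := fun (s : ℝ) (z : Config (N + 1) (Fin 3) T3) (x : T3) =>
          2 / 3 * (En s z x / R s z x - ‖Mv s z x‖ ^ 2 / (2 * R s z x ^ 2))
        let Fc := fun η : ℝ => hsExcessFreeEnergy (min η η₁) + (hsCompressibility η₁ - 1) * Real.log (max η η₁ / η₁)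
        let Zs := fun (s : ℝ) (z : Config (N + 1) (Fin 3) T3) (x : T3) =>
          max a (min (3 / 2 * Real.log (Θ s z x) - Real.log (R s z x) - Fc (R s z x * σ ^ 3)) b)
        let D : Config (N + 1) (Fin 3) T3 → ℝ := fun z =>
          (∫ s in Ioc 0 τ, ∫ x,
              (R s z x * Zs s z x * Literature.Analysis.FunctionSpaces.Torus.timeDerivWithin (Ico 0 T') φ s x +
                Zs s z x * ⟪Mv s z x, Literature.Analysis.FunctionSpaces.Torus.gradient (φ s) x⟫_ℝ)) -
            (∫ x, R τ z x * Zs τ z x * φ τ x) + (∫ x, R 0 z x * Zs 0 z x * φ 0 x)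
        Integrable D (localGibbsLaw σ a₀ u₀ θ₀ N (Φ N)) ∧
          ∫ z, D z ∂(localGibbsLaw σ a₀ u₀ θ₀ N (Φ N)) ≤ ε

/-- **The re-typed crux**: the annealed kernel-format inputs K1ker and K2ker imply the packing-guarded
hydrodynamic limit (conclusion VERBATIM the body of `AnnealedWeakStrong`, i.e. the sub-problem Statement).
Intended proof = Březina–Feireisl Thm 3.3 run IN EXPECTATION at finite `N` on
`e^k_N(τ) = E∫ ℰ_{Z_{a,b}}(U^k_N(τ,x) | ρ,θ,u(τ,x)) dx` for the cut law (energy tested with `1`: exact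
conservation; continuity exact: `MassContinuity`; momentum: K1ker with `w = ū`-built fields; entropy: K2ker
with `φ = θ̄`-built fields; BF18 master pointwise inequality and coercivity from `MVRelativeEnergy*`,
`HsEntropyConvex`, `HsEosLowDensity` — all in tree), then `ℓ → 0` (bias `O(ℓ²)` of `k * Ū(0)`), then the
landed S3b/S3c of line `registered` turn `e^k_N → 0` into `TendstoHydroFieldsAt`. This is route
BoxDissipativeWeakStrong's K3 `RelativeEnergyStability` (stmt-17653, line active) with box kernels at kinetic
windows replaced by continuous kernels at macroscopic radius. -/
def AnnealedWeakStrongRetyped : Prop :=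
  MeanMomentumFluxClosureCut → MeanLocalEntropyInequality →
    ∃ η₀ : ℝ, 0 < η₀ ∧ ∀ (a₀ θ₀ : T3 → ℝ) (u₀ : T3 → V3), Continuous a₀ → Continuous θ₀ → Continuous u₀ →
      (∀ x, 0 < a₀ x) → (∀ x, 0 < θ₀ x) →
      ∃ σ₀ : ℝ, 0 < σ₀ ∧ ∀ σ : ℝ, 0 < σ → σ < σ₀ →
        ∀ (T : ℝ) (ρ θ : ℝ → T3 → ℝ) (u : ℝ → T3 → V3), IsHardSphereEulerSolution σ T ρ u θ →
          (∀ t ∈ Ico 0 T, ∀ x, ρ t x * σ ^ 3 < η₀) →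
          ∀ Φ : (N : ℕ) → HardSphereFlow (Literature.Analysis.FluidPDE.Torus.geometry (Fin 3)) (hsDiameter σ N) (N + 1),
            TendstoHydroFieldsAt (fun N => localGibbsLaw σ a₀ u₀ θ₀ N (Φ N)) Φ ρ u θ 0 →
              ∀ t ∈ Ico 0 T, TendstoHydroFieldsAt (fun N => localGibbsLaw σ a₀ u₀ θ₀ N (Φ N)) Φ ρ u θ t

/-- Sanity check (definitional): the re-typed crux has VERBATIM the conclusion of `AnnealedWeakStrong`, so the
route's deciding theorem keeps its shape: `closes' h1 h2 h := h h1 h2 : HydrodynamicLimit`. -/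
theorem closes_retyped (h₁ : MeanMomentumFluxClosureCut) (h₂ : MeanLocalEntropyInequality)
    (h : AnnealedWeakStrongRetyped) : _root_.HydrodynamicLimit :=
  h h₁ h₂

end Summit.AtomisticToContinuum.HydrodynamicLimit.Theorems.AWS.Retype

end
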